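import Summits.Langlands.Langlands.Theorems.PhantomRMYoshidaResiduallyYoshidaLiftingDefs
import HarnessLib

/-!
# Route `PhantomRMYoshida`, crux `ResiduallyYoshidaLifting` (stmt-Langlands-13639): typed currency of the
# GREENBERG–SELMER SPACE of a residual Yoshida pair (route-posited objects, D-0016 `<Route>Defs`-type file)

DEFINITIONS ONLY (no sorry; nothing is asserted — every `def … : Prop` below is a *statement* consumed only as part of
the type of a registered stub of the crux item).  This is the vocabulary that the design notes of line
`sector-klingen-split` have requested since lead c3-0 (`Lines/sector-klingen-split-next.md` N3: "a group-cohomology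
`H¹_f` for framed residual pairs"), in the EXPLICIT COCYCLE form in which the landed theorems of leads c3–c5 are stated:

* `IsRealisedThrough p k red σ σ' r B` — "`r` realises the cocycle `B`": an integral frame `rint = P⁻¹ r P` of `r`
  whose reduction through `red` is `GL₄(k)`-conjugate to the block matrix `(σ̄, B; 0, σ̄')` (verbatim the clause used in
  every registered stub of the line since rev 2a; the `let Real`/`let Fr` of K2⁺/RC).
* `IsCoboundaryFor σ σ' B` — `B = σ̄ X - X σ̄'` for some `X ∈ M₂(k)`.
* `IsGreenbergDecAt p k σ σ' v B` — the DECOMPOSITION-GROUP Greenberg condition at `v ∣ p` (the nine clauses of the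
  landed N1⁺ `Fibre.stub_greenbergStablePlane`, p168218; verbatim the `let GrDec` of K2⁺ p169418 and RC p170002): lines
  `k x₁ ⊆ σ̄`, `k y₁ ⊆ σ̄'` stable under `G_v`, fixed by `I_v`, and a correction `X₀` such that `B - δX₀` maps `y₁` into
  `k x₁` on `G_v`, kills `y₁` on `I_v`, and maps all of `σ̄'` into `k x₁` on `I_v` — the residual Siegel-ordinary local
  condition of shape `(0,0,1,1)`.
* `IsGreenbergSelmerCocycle p k σ σ' S B` — 1-cocycle for `Hom(σ̄', σ̄)`, locally constant, vanishing on the inertia groups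
  above every `v ∉ S`, and `IsGreenbergDecAt` at every `v ∣ p` (verbatim the conclusion of the landed K3⁺
  `Fibre.stub_realisedClassSelmerDec`, p168375, for the ramification set of the realiser).
* `GreenbergSelmerRankLeOne p k σ σ' S` — any two such cocycles that are not coboundaries are projectively equal modulo
  coboundaries: the Greenberg–Selmer space with ramification inside `S` has RANK AT MOST ONE (Berger–Klosin's uniqueness
  regime; verbatim the rank-one hypothesis of K2⁺/RC).  By the landed GL `Fibre.stub_greenbergDecIntrinsic` (p170787)
  the condition `IsGreenbergDecAt` is `k`-linear and contains the coboundaries, so this is a statement about CLASSES.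

What is NOT here: any theorem beyond the definitional `stub_greenbergSelmerRankLeOne_iff` (`Iff.rfl`; a registered
sub-goal of the crux item, so that this definitions module lands `--supports` it).  Declared in the namespace of the
lead's registered skeleton `Summit.Langlands.Langlands.Cruxes.ResiduallyYoshidaLifting.SectorKlingenSplit`.

References: R. Greenberg, Iwasawa theory for motives, in L-functions and Arithmetic (Durham 1989), LMS LNS 153 (1991) [Greenberg1991,
§1–2 (the ordinary local condition)]; T. Berger, K. Klosin, On deformation rings of residually reducible Galois
representations and R = T theorems, Math. Ann. 355 (2013) [BergerKlosin2012, §2 (Selmer groups), §3 (uniqueness of the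
residual extension)].
-/

noncomputable section

-- `Summit.Langlands.Langlands.…` (summit = sub-problem name, D-0017 layout) trips `dupNamespace` on every decl.
set_option linter.dupNamespace false
set_option autoImplicit false

open IsDedekindDomain Filter
open scoped Matrix
open Literature.NumberTheory.GaloisRepresentations Literature.NumberTheory.Automorphic

namespace Summit.Langlands.Langlands.Cruxes.ResiduallyYoshidaLifting.SectorKlingenSplit

/-- **"`r` REALISES the cocycle `B` through `red`"**: there is an integral frame `rint = P⁻¹ r P` of
`r : Γ_ℚ → GL₄(ℚ̄_p)` (a homomorphism into `GL₄(ℤ̄_p)`) whose reduction through `red : ℤ̄_p → k` is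
`GL₄(k)`-conjugate (by `h`) to the block upper-triangular `(σ̄, B; 0, σ̄')` (verbatim the realisation clause of every
registered stub of line `sector-klingen-split`; by Theorems/…RibetRealisation it depends only on `kˣ · [B]`). [folklore] -/
def IsRealisedThrough (p : ℕ) [Fact p.Prime] (k : Type) [Field k] [TopologicalSpace k] [DiscreteTopology k]
    (red : Valued.integer (PadicAlgCl p) →+* k) (σ σ' : FramedGaloisRep ℚ k 2)
    (r : FramedGaloisRep ℚ (PadicAlgCl p) 4) (B : Field.absoluteGaloisGroup ℚ → Matrix (Fin 2) (Fin 2) k) : Prop :=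
  ∃ (P : GL (Fin 4) (PadicAlgCl p))
    (rint : Field.absoluteGaloisGroup ℚ →* GL (Fin 4) (Valued.integer (PadicAlgCl p))) (h : GL (Fin 4) k),
    (∀ g, Matrix.GeneralLinearGroup.map (Valued.integer (PadicAlgCl p)).subtype (rint g) = P⁻¹ * r g * P) ∧
    (∀ g, (Matrix.GeneralLinearGroup.map red (rint g)).val =
      h.val * Matrix.reindex finSumFinEquiv finSumFinEquiv
        (Matrix.fromBlocks (σ g).val (B g) 0 (σ' g).val) * (h⁻¹).val)

/-- **`B` is a COBOUNDARY for the pair `(σ̄, σ̄')`**: `B = σ̄ X - X σ̄'` for some `X ∈ M₂(k)` (the trivial classes of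
`H¹(Γ_ℚ, Hom(σ̄', σ̄))` in matrix form). [folklore] -/
def IsCoboundaryFor {k : Type} [Field k] [TopologicalSpace k] (σ σ' : FramedGaloisRep ℚ k 2)
    (B : Field.absoluteGaloisGroup ℚ → Matrix (Fin 2) (Fin 2) k) : Prop :=
  ∃ X : Matrix (Fin 2) (Fin 2) k, ∀ g, B g = (σ g).val * X - X * (σ' g).val

/-- **The DECOMPOSITION-GROUP GREENBERG CONDITION at `v ∣ p`** for a `Hom(σ̄', σ̄)`-valued cochain `B` (the residual
Siegel-ordinary local condition of shape `(0,0,1,1)`; verbatim the conclusion of the landed N1⁺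
`Fibre.stub_greenbergStablePlane` and the `let GrDec` of K2⁺/RC): there are non-zero `x₁ ∈ σ̄`, `y₁ ∈ σ̄'` spanning
`G_v`-stable lines fixed by inertia `I_v` (the Greenberg lines) and a correction `X₀` such that the corrected cochain
`B - δX₀`, `δX₀ = σ̄ X₀ - X₀ σ̄'`, maps `y₁` into `k x₁` on `G_v`, kills `y₁` on `I_v`, and maps ALL of `σ̄'` into `k x₁`
on `I_v`. [cite: Greenberg1991, §2 (the ordinary local condition F⁺ of an ordinary p-adic representation)] -/
def IsGreenbergDecAt (p : ℕ) [Fact p.Prime] (k : Type) [Field k] [TopologicalSpace k]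
    (σ σ' : FramedGaloisRep ℚ k 2) (v : HeightOneSpectrum (NumberField.RingOfIntegers ℚ))
    (B : Field.absoluteGaloisGroup ℚ → Matrix (Fin 2) (Fin 2) k) : Prop :=
  ∃ (X₀ : Matrix (Fin 2) (Fin 2) k) (x₁ y₁ : Fin 2 → k), x₁ ≠ 0 ∧ y₁ ≠ 0 ∧
    (∀ τ : Field.absoluteGaloisGroup (v.adicCompletion ℚ), ∃ a : k,
      (σ (absGaloisRestrict ℚ (v.adicCompletion ℚ) τ)).val *ᵥ x₁ = a • x₁) ∧
    (∀ τ : Field.absoluteGaloisGroup (v.adicCompletion ℚ), ∃ b : k,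
      (σ' (absGaloisRestrict ℚ (v.adicCompletion ℚ) τ)).val *ᵥ y₁ = b • y₁) ∧
    (∀ τ : Field.absoluteGaloisGroup (v.adicCompletion ℚ), ∃ c : k,
      (B (absGaloisRestrict ℚ (v.adicCompletion ℚ) τ) -
        ((σ (absGaloisRestrict ℚ (v.adicCompletion ℚ) τ)).val * X₀ -
          X₀ * (σ' (absGaloisRestrict ℚ (v.adicCompletion ℚ) τ)).val)) *ᵥ y₁ = c • x₁) ∧
    (∀ τ ∈ absInertia (v.adicCompletion ℚ),
      (σ (absGaloisRestrict ℚ (v.adicCompletion ℚ) τ)).val *ᵥ x₁ = x₁) ∧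
    (∀ τ ∈ absInertia (v.adicCompletion ℚ),
      (σ' (absGaloisRestrict ℚ (v.adicCompletion ℚ) τ)).val *ᵥ y₁ = y₁) ∧
    (∀ τ ∈ absInertia (v.adicCompletion ℚ),
      (B (absGaloisRestrict ℚ (v.adicCompletion ℚ) τ) -
        ((σ (absGaloisRestrict ℚ (v.adicCompletion ℚ) τ)).val * X₀ -
          X₀ * (σ' (absGaloisRestrict ℚ (v.adicCompletion ℚ) τ)).val)) *ᵥ y₁ = 0) ∧
    ∀ τ ∈ absInertia (v.adicCompletion ℚ), ∀ y : Fin 2 → k, ∃ c : k,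
      (B (absGaloisRestrict ℚ (v.adicCompletion ℚ) τ) -
        ((σ (absGaloisRestrict ℚ (v.adicCompletion ℚ) τ)).val * X₀ -
          X₀ * (σ' (absGaloisRestrict ℚ (v.adicCompletion ℚ) τ)).val)) *ᵥ y = c • x₁

/-- **GREENBERG–SELMER COCYCLE with ramification inside `S`** for the pair `(σ̄, σ̄')`: a 1-cocycle for `Hom(σ̄', σ̄)`
(`B(gg') = σ̄ g · B g' + B g · σ̄' g'`), locally constant on `Γ_ℚ`, vanishing on the inertia groups above every place
`v ∉ S`, and satisfying the decomposition-group Greenberg condition at every `v ∣ p` (verbatim the conclusion of the landed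
K3⁺ `Fibre.stub_realisedClassSelmerDec`: the class realised by an `Sh`-point unramified outside `S` is one).
[cite: Greenberg1991, §2 (the Selmer group of an ordinary representation)] -/
def IsGreenbergSelmerCocycle (p : ℕ) [Fact p.Prime] (k : Type) [Field k] [TopologicalSpace k]
    (σ σ' : FramedGaloisRep ℚ k 2) (S : Set (HeightOneSpectrum (NumberField.RingOfIntegers ℚ)))
    (B : Field.absoluteGaloisGroup ℚ → Matrix (Fin 2) (Fin 2) k) : Prop :=
  (∀ g g', B (g * g') = (σ g).val * B g' + B g * (σ' g').val) ∧ IsLocallyConstant B ∧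
    (∀ v ∉ S, ∀ 𝔓 ∈ v.primesAbove, ∀ i ∈ 𝔓.inertia (Field.absoluteGaloisGroup ℚ), B i = 0) ∧
    ∀ v : HeightOneSpectrum (NumberField.RingOfIntegers ℚ), ((p : ℕ) : NumberField.RingOfIntegers ℚ) ∈ v.asIdeal →
      IsGreenbergDecAt p k σ σ' v B

/-- **The Greenberg–Selmer space with ramification inside `S` has RANK AT MOST ONE**: any two Greenberg–Selmer cocycles
that are not coboundaries are projectively equal modulo coboundaries (`B₂ = c • B₁ + δX`, `c ∈ kˣ`) — the uniqueness
regime of Berger–Klosin, in which the landed K2⁺ (p169418) discharges the anchor stub of line `sector-klingen-split` by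
the crux's own `ρ₀` and the landed RC (p170002) makes the residual representation constant along the fibre.
[cite: BergerKlosin2012, §3 (dim H¹ = 1: uniqueness of the non-split residual extension)] -/
def GreenbergSelmerRankLeOne (p : ℕ) [Fact p.Prime] (k : Type) [Field k] [TopologicalSpace k]
    (σ σ' : FramedGaloisRep ℚ k 2) (S : Set (HeightOneSpectrum (NumberField.RingOfIntegers ℚ))) : Prop :=
  ∀ B₁ B₂ : Field.absoluteGaloisGroup ℚ → Matrix (Fin 2) (Fin 2) k,
    IsGreenbergSelmerCocycle p k σ σ' S B₁ → IsGreenbergSelmerCocycle p k σ σ' S B₂ →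
    ¬ IsCoboundaryFor σ σ' B₁ → ¬ IsCoboundaryFor σ σ' B₂ →
    ∃ (c : kˣ) (X : Matrix (Fin 2) (Fin 2) k), ∀ g, B₂ g = (c : k) • B₁ g + ((σ g).val * X - X * (σ' g).val)

/-- STUB (definitional; registered sub-goal of stmt-Langlands-13639 so that this definitions-only currency module lands
`--supports` the crux): `GreenbergSelmerRankLeOne` reads, over `IsGreenbergSelmerCocycle` / `IsCoboundaryFor`, literally
as the rank-one hypothesis of the landed K2⁺ `stub_selmerAnchorRel_of_rankOneDec` and RC `stub_residualConstancyOfRankOne`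
— `Iff.rfl`. [folklore] -/
theorem stub_greenbergSelmerRankLeOne_iff :
    ∀ (p : ℕ) [Fact p.Prime] (k : Type) [Field k] [TopologicalSpace k]
      (σ σ' : FramedGaloisRep ℚ k 2) (S : Set (HeightOneSpectrum (NumberField.RingOfIntegers ℚ))),
      GreenbergSelmerRankLeOne p k σ σ' S ↔
        ∀ B₁ B₂ : Field.absoluteGaloisGroup ℚ → Matrix (Fin 2) (Fin 2) k,
          IsGreenbergSelmerCocycle p k σ σ' S B₁ → IsGreenbergSelmerCocycle p k σ σ' S B₂ →
          ¬ IsCoboundaryFor σ σ' B₁ → ¬ IsCoboundaryFor σ σ' B₂ →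
          ∃ (c : kˣ) (X : Matrix (Fin 2) (Fin 2) k), ∀ g,
            B₂ g = (c : k) • B₁ g + ((σ g).val * X - X * (σ' g).val) :=
  fun _ _ _ _ _ _ _ _ => Iff.rfl

end Summit.Langlands.Langlands.Cruxes.ResiduallyYoshidaLifting.SectorKlingenSplit

end
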